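import Summits.ABC.IUTFork.GenEllAbcFinal
import Literature.NumberTheory.DiophantineGeometry.GenEllThm21PrimesHolds
import HarnessLib

/-!
# Campaign-S endpoint, unconditional form: `[IUTchIV] Cor 2.2 ⟹ ABC` with NO classical named fact left

Companion of `GenEllAbc.lean` / `GenEllAbcFinal.lean` (abc-iut cell, campaign S, TRANCHE-T1 P06; the
lineage abc-iut-S4).  The endpoint of record `ABC_of_corollary22_primes` took ONE classical named fact,
the FAITHFUL [GenEll] Thm. 2.1 (ii) ⟹ (i)|_{ℙ¹} for finite sets of prime numbers
(`GenEll.GenEll_thm21_primes`, FACT-LIST F-1336).  That fact is now a tree THEOREM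
(`GenEll.GenEll_thm21_primes_holds`, `Literature/NumberTheory/DiophantineGeometry/GenEllThm21PrimesHolds.lean`:
the cell's number-field-only proof — Kummer covers `D_e`, explicit noncritical Belyi maps, Prop. 1.6/1.7
bookkeeping with defects, compactness of bounded-degree conjugate configurations — run at an arbitrary
finite set of primes `Σ`), so the typed [IUTchIV] Corollary 2.2 (`Cor22.Corollary22 H_unif`, abc-iut-S3)
implies the summit statement `ABC` OUTRIGHT in the kernel:

* `ABC_of_corollary22` — `Cor22.Corollary22 H_unif → ABC`, no hypothesis besides Cor. 2.2 itself;
* `ABC_of_abcCompactlyBounded` — statement (ii) of [GenEll] Thm. 2.1 at any finite set of primes `Σ`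
  implies `ABC` (the `Σ`-general form of what the route item `GenEllTwo` gives at `Σ = {2}`).

HONEST FRAMING: `Cor22.Corollary22` is the typed DIOPHANTINE OUTPUT of the disputed chain
`[IUTchIII] Cor 3.12 ⟹ [IUTchIV] Thm 1.10 ⟹ Cor 2.2` (never asserted in the tree); this file takes no
side and asserts nothing disputed — it only removes the last CLASSICAL hypothesis from the downstream
end of campaign S.  [cite: MochizukiGenEll2010, Thm 2.1 p.11]; [IUTchIV] Cor. 2.2–2.3 pp. 41–55
[claim: Mochizuki2012, status: disputed] (only the shape of the reduction is used).
-/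

namespace Summit.ABC.IUTFork

open Literature.NumberTheory.DiophantineGeometry.GenEll Literature.IUT.LogVolume

/-- **`[IUTchIV] Cor 2.2 ⟹ ABC`, unconditionally in its classical inputs**: the typed [IUTchIV]
Corollary 2.2 (`Cor22.Corollary22 H_unif`, abc-iut-S3; downstream of the disputed [IUTchIII] Cor. 3.12,
never asserted) implies the summit statement `ABC` — [GenEll] Thm. 2.1 (`GenEll_thm21_primes_holds`)
and Krasner's finiteness (`wlog_jInv`) being tree theorems.  TAKES NO SIDE.
[claim: Mochizuki2012, status: disputed] -/
theorem ABC_of_corollary22 {Hunif : ℝ} (h22 : Cor22.Corollary22 Hunif) : _root_.ABC :=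
  ABC_of_corollary22_primes GenEll_thm21_primes_holds h22

/-- **[GenEll] Thm. 2.1 (ii) at any finite set of primes `Σ` ⟹ `ABC`** (unconditional): Vojta's
height inequality on the `Σ`-supported compactly bounded subsets of `ℙ¹ ∖ {0,1,∞}`, in every bounded
degree, implies the abc conjecture. [cite: MochizukiGenEll2010, Thm 2.1 p.11] -/
theorem ABC_of_abcCompactlyBounded {S : Finset ℕ} (hS : ∀ p ∈ S, p.Prime)
    (h : ABCCompactlyBounded S) : _root_.ABC :=
  (ABC_iff).2 (abc_of_abcCompactlyBounded_of_primes hS h)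

end Summit.ABC.IUTFork
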